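/-
Copyright: the b2b-balaban cell (near-miss cell 7), T⁴-continuum fan-out; row NE7b ROUND-2 swarm, seat
t4-ne7b-formalise-leaf-10 (gen 3; sub-row S6g′(f) of `t4/b2b-balaban-t4-ne7b-p1/LEAVES-NE7b.md`, owner's rulings
R-OWNER-22-12 (2), 22-18, 22-19).  Released under the licence of the surrounding project.
-/
import Summits.QuantumFields.BalabanUV.T4Continuum.Support.HistorySiblingEntropyGenT

/-!
# Sibling entropy bound, the SORTED bridge: the display `ShapeSorted` ELIMINATED — the shape map sorts each join's
# non-host parts itself; the one remaining order display is `InjPartsS` (row S6g′(f))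

Summits-side support leaf of the T⁴-continuum cell (rung (B)+1 on a FINITE torus only; NOT infinite volume, NOT the
mass gap, NOT the Clay statement; NOT a proof of the spine estimate NE7b).  Row NE7b, route «COUNT», row S6g′
«MASS-BASED SIBLING COUNT»; sequel of `HistorySiblingEntropyBridge`∕`…Discharge`∕`…GenT`.  [folklore] well-founded
recursion over the lineage's own carrier and finite sums; nothing is quoted from print, nothing printed is asserted,
no `[cite:]` tag, no `Prop` fact minted.

WHY.  The abstract theorem (`HistorySiblingEntropyBound.ent_le_two_mul_phi`) needs CANONICAL shapes (sorted part
lists).  The first bridge (`toShape`) listed the non-host parts in the member's own index order and therefore displayed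
`ShapeSorted` — which, for members realised along `Realises`' prefix-contact chains, is NOT available as an encoding
convention (F-leaf10-4, R-OWNER-22-18∕19).  But the order of the ABSTRACT list is ours to choose: **`toShapeS`**
sorts the non-host shapes by `enc` INSIDE the map (`List.mergeSort`), so `Canon (toShapeS G)` holds for EVERY `G`
(`canon_toShapeS`, no hypothesis), while `Φ` and the join entropies are invariant under the permutation
(`List.mergeSort_perm`).  The member's own order now enters ONLY through the classes: the remaining display
**`InjPartsS`** — «at every join, non-host parts with equal SORTED shapes are equal sub-structures» — is exactly
«ordered classes = unordered classes (and renewal decorations canonical)», the property R-OWNER-22-18∕19's row S1c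
(order-free realisation + canonical listing) delivers; on a member with order-variant or renewal-variant siblings it
fails, and there the ordered entropy is genuinely larger (F-leaf10-4 §2).

WHAT.  `encLE`, `sortS` (+ perm∕pairwise), **`toShapeS`**, `InjPartsS`; `toShapeS_root`, `wf_toShapeS` (⇐ `Mono`),
**`canon_toShapeS`** (unconditional), `phi_toShapeS`, `lmult_eq_logMultinomial_csize_of` (the class lemma for any
shape reading `ψ` of the parts), `ent_toShapeS` (⇐ `InjPartsS`), and the ENDs **`E_leS`** ∕ **`ENT_leS`**:
`Mono st G → InjPartsS st fat G → ENT st G ≤ 2·bsum (1 + fat) G + 2·partnerAges st G + 4·mrg st G`; on pedigrees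
`Mono` is free (`mono_genT`): **`ENT_le_genT`** needs `HeadOldest` + `InjPartsS` only.

HONEST SCOPE.  `InjPartsS` displayed (the content of row S1c); nothing of H3∕(B)∕BetaPertH touched.  NE7b NOT proved.
HONEST DEPENDENCY (cell): continuum YM on T⁴ ⇐ BetaPertH ∧ nine spine estimates (0/9 proved); BetaPertH ⇐ (D1) ∧ (D4)
∧ CAP+tail; G-an2-4 gates asym, D1 and NE2/3/4.  This file changes none of it.
-/

open Finset
open Literature.MathematicalPhysics.QuantumFieldTheory.Balaban1983to89
open T4PersistenceDictionary T4PartnerMultiplicity T4BranchingRecordsGas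
open Summit.QuantumFields.BalabanUV.T4Continuum.HistoryJoins
open Summit.QuantumFields.BalabanUV.T4Continuum.HistoryJoinsAdm
open Summit.QuantumFields.BalabanUV.T4Continuum.HistoryJoinsClass
open Summit.QuantumFields.BalabanUV.T4Continuum.HistorySiblingEntropy
open Summit.QuantumFields.BalabanUV.T4Continuum.HistorySiblingEntropyBound
open Summit.QuantumFields.BalabanUV.T4Continuum.HistoryJoinsBudget (mrg)
open Summit.QuantumFields.BalabanUV.T4Continuum.HistoryJoinsEntropyBudget (ent ENT)

namespace Summit.QuantumFields.BalabanUV.T4Continuum.HistorySiblingEntropyBridge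

noncomputable section

open scoped Classical

/-! ## §1 Sorting shapes by the canonical injection -/

/-- the canonical comparison [folklore] -/
def encLE (x y : Shape) : Bool := decide (enc x ≤ enc y)

/-- **THE CANONICAL SORT** of a list of shapes [folklore] -/
def sortS (l : List Shape) : List Shape := l.mergeSort encLE

/-- the sort is a permutation [folklore] -/
theorem sortS_perm (l : List Shape) : (sortS l).Perm l := List.mergeSort_perm l encLE

/-- the sort is sorted [folklore] -/
theorem sortS_pairwise (l : List Shape) : (sortS l).Pairwise fun x y => enc x ≤ enc y := by
  have h := List.pairwise_mergeSort (le := encLE)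
    (fun a b c hab hbc => by simp only [encLE, decide_eq_true_eq] at hab hbc ⊢; exact hab.trans hbc)
    (fun a b => by simp only [encLE, Bool.or_eq_true, decide_eq_true_eq]; exact le_total _ _) l
  exact h.imp fun hab => by simpa [encLE] using hab

/-- membership is unchanged by sorting [folklore] -/
theorem mem_sortS {l : List Shape} {x : Shape} : x ∈ sortS l ↔ x ∈ l := (sortS_perm l).mem_iff

variable {ε : Type*} (st : ε → ℕ) (fat : ε → ℕ)

/-- **THE SORTED SHAPE OF A GENEALOGY**: as `toShape`, but each join's non-host shapes are SORTED by `enc`. [folklore] -/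
def toShapeS : Gen ε → Shape
  | Gen.born b j => .atom j (fat b)
  | Gen.renew G _ _ => toShapeS G
  | Gen.merge X Y e =>
      .join (st e + 1) (toShapeS (part st (Gen.merge X Y e) (hostIdx st X Y e)).2)
        (ofList (sortS ((nonhost st X Y e).map fun i => toShapeS (part st (Gen.merge X Y e) i).2)))
termination_by G => gsize G
decreasing_by
  all_goals first
    | (simp only [gsize]; omega)
    | exact gsize_lt_of_mem_jparts st _ _ (part_mem st _ _)

/-- unfolding at a birth [folklore] -/
@[simp] theorem toShapeS_born (b : ε) (j : ℕ) : toShapeS st fat (Gen.born b j) = .atom j (fat b) := by rw [toShapeS]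
/-- unfolding at a renewal [folklore] -/
@[simp] theorem toShapeS_renew (G : Gen ε) (e : ε) (h : ℕ) :
    toShapeS st fat (Gen.renew G e h) = toShapeS st fat G := by rw [toShapeS]
/-- unfolding at a merger [folklore] -/
theorem toShapeS_merge (X Y : Gen ε) (e : ε) :
    toShapeS st fat (Gen.merge X Y e) =
      .join (st e + 1) (toShapeS st fat (part st (Gen.merge X Y e) (hostIdx st X Y e)).2)
        (ofList (sortS ((nonhost st X Y e).map fun i => toShapeS st fat (part st (Gen.merge X Y e) i).2))) := by
  rw [toShapeS]

/-- **THE ONE ORDER DISPLAY**: at every join, non-host parts with equal SORTED shapes are equal sub-structures.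
[folklore] -/
def InjPartsS : Gen ε → Prop
  | Gen.born _ _ => True
  | Gen.renew G _ _ => InjPartsS G
  | Gen.merge X Y e => (∀ i, InjPartsS (part st (Gen.merge X Y e) i).2) ∧
      ∀ i j, i ≠ hostIdx st X Y e → j ≠ hostIdx st X Y e →
        toShapeS st fat (part st (Gen.merge X Y e) i).2 = toShapeS st fat (part st (Gen.merge X Y e) j).2 →
          (part st (Gen.merge X Y e) i).2 = (part st (Gen.merge X Y e) j).2
termination_by G => gsize G
decreasing_by
  all_goals first
    | (simp only [gsize]; omega)
    | exact gsize_lt_of_mem_jparts st _ _ (part_mem st _ _)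

/-! ## §2 The bridge lemmas for the sorted shape -/
/-- the root is the root step [folklore] -/
theorem toShapeS_root : ∀ G : Gen ε, (toShapeS st fat G).root = G.rootStep
  | Gen.born b j => by simp [Shape.root]
  | Gen.renew G e h => by rw [toShapeS_renew, toShapeS_root G]; rfl
  | Gen.merge X Y e => by
      rw [toShapeS_merge, Shape.root, toShapeS_root (part st (Gen.merge X Y e) (hostIdx st X Y e)).2,
        ← rootStep_eq_host]
termination_by G => gsize G
decreasing_by
  all_goals first
    | (simp only [gsize]; omega)
    | exact gsize_lt_of_mem_jparts st _ _ (part_mem st _ _)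

/-- the last event of the sorted shape is at most the top step (plus one at a merger), under `Mono` [folklore] -/
theorem lastS_toShape_le : ∀ G : Gen ε, Mono st G →
    (toShapeS st fat G).last ≤ top st G + (match G with | Gen.merge _ _ _ => 1 | _ => 0)
  | Gen.born b j, _ => by simp [Shape.last, top]
  | Gen.renew G e h, hm => by
      simp only [Mono] at hm
      have ih := lastS_toShape_le G hm.1
      rw [toShapeS_renew]
      have : (match (G : Gen ε) with | Gen.merge _ _ _ => 1 | _ => 0) ≤ 1 := by
        cases G <;> simp
      simp only [top]
      omega
  | Gen.merge X Y e, _ => by rw [toShapeS_merge]; simp [Shape.last, top]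

/-- a part of the top join of a `Mono` merger has its sorted shape's last event at most the join step [folklore] -/
theorem lastS_part_le {X Y : Gen ε} {e : ε} (hm : Mono st (Gen.merge X Y e)) (i : Fin (npart st (Gen.merge X Y e))) :
    (toShapeS st fat (part st (Gen.merge X Y e) i).2).last ≤ st e := by
  have hq : part st (Gen.merge X Y e) i ∈ clusterParts st (st e) (Gen.merge X Y e) := part_mem st _ i
  have hmq := mono_of_mem_clusterParts st (st e) _ hm _ hq
  have htq := top_le_of_mem_clusterParts st (st e) _ hm (by simp [top]) _ hq
  have hl := lastS_toShape_le st fat _ hmq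
  generalize hq2 : (part st (Gen.merge X Y e) i).2 = q at hmq htq hl hq
  cases q with
  | born b j =>
      rw [toShapeS_born]
      simp only [top] at htq
      exact htq
  | renew G e' h =>
      rw [toShapeS_renew]
      rw [toShapeS_renew] at hl
      simp only [top] at hl htq
      omega
  | merge X' Y' e' =>
      have hne := st_ne_of_mem_clusterParts st (st e) _ _ hq X' Y' e' hq2
      rw [toShapeS_merge]
      simp only [top] at htq
      simp only [Shape.last]
      omega

/-- **WELL-FORMEDNESS OF THE SORTED SHAPE** from the displayed chronology. [folklore] -/
theorem wf_toShapeS : ∀ G : Gen ε, Mono st G → (toShapeS st fat G).WF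
  | Gen.born b j, _ => by simp [Shape.WF]
  | Gen.renew G e h, hm => by rw [toShapeS_renew]; exact wf_toShapeS G hm.1
  | Gen.merge X Y e, hm => by
      rw [toShapeS_merge]
      have hparts : ∀ i, (toShapeS st fat (part st (Gen.merge X Y e) i).2).WF := fun i =>
        wf_toShapeS (part st (Gen.merge X Y e) i).2 (mono_of_mem_clusterParts st (st e) _ hm _ (part_mem st _ i))
      refine ⟨hparts _, Nat.lt_succ_of_le (lastS_part_le st fat hm _), ?_, ?_⟩
      · have hn2 : 2 ≤ npart st (Gen.merge X Y e) := by
          have h1 := one_le_length_clusterParts st (st e) X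
          have h2 := one_le_length_clusterParts st (st e) Y
          have : (jparts st (Gen.merge X Y e)).length =
              (clusterParts st (st e) X).length + (clusterParts st (st e) Y).length := by
            rw [jparts_merge, List.length_append, List.length_map, List.length_map]
          simp only [npart]; omega
        intro h0
        have hlen := congrArg (fun ps => ps.toList.length) h0
        simp only [toList_ofList, Parts.toList, List.length_nil] at hlen
        rw [(sortS_perm _).length_eq, List.length_map] at hlen
        obtain ⟨i, hi⟩ : ∃ i : Fin (npart st (Gen.merge X Y e)), i ≠ hostIdx st X Y e :=
          Fintype.exists_ne_of_one_lt_card (by simp; omega) _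
        have : i ∈ nonhost st X Y e := (mem_nonhost st).2 hi
        rw [List.length_eq_zero_iff.1 hlen] at this
        simp at this
      · rw [Parts.wf_iff, toList_ofList]
        intro x hx
        obtain ⟨i, _, rfl⟩ := List.mem_map.1 (mem_sortS.1 hx)
        exact ⟨hparts i, Nat.lt_succ_of_le (lastS_part_le st fat hm i)⟩
termination_by G => gsize G
decreasing_by
  all_goals first
    | (simp only [gsize]; omega)
    | exact gsize_lt_of_mem_jparts st _ _ (part_mem st _ _)

/-- **CANONICITY OF THE SORTED SHAPE — UNCONDITIONAL.** [folklore] -/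
theorem canon_toShapeS : ∀ G : Gen ε, (toShapeS st fat G).Canon
  | Gen.born b j => by simp [Shape.Canon]
  | Gen.renew G e h => by rw [toShapeS_renew]; exact canon_toShapeS G
  | Gen.merge X Y e => by
      rw [toShapeS_merge]
      refine ⟨canon_toShapeS _, ?_, by rw [toList_ofList]; exact sortS_pairwise _⟩
      rw [Parts.canon_iff, toList_ofList]
      intro x hx
      obtain ⟨i, _, rfl⟩ := List.mem_map.1 (mem_sortS.1 hx)
      exact canon_toShapeS _
termination_by G => gsize G
decreasing_by
  all_goals first
    | (simp only [gsize]; omega)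
    | exact gsize_lt_of_mem_jparts st _ _ (part_mem st _ _)

/-- **THE BUDGET OF THE SORTED SHAPE**: `Φ(toShapeS G) = bsum (1 + fat) G + AG G` (the sort is a permutation).
[folklore] -/
theorem phi_toShapeS : ∀ G : Gen ε,
    ((toShapeS st fat G).phi : ℝ) = bsum (fun b => (1 : ℝ) + fat b) G + (AG st G : ℝ)
  | Gen.born b j => by rw [toShapeS_born, AG]; simp [Shape.phi, bsum]
  | Gen.renew G e h => by rw [toShapeS_renew, AG, phi_toShapeS G]; rfl
  | Gen.merge X Y e => by
      rw [toShapeS_merge, AG]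
      simp only [Shape.phi, Nat.cast_add, Nat.cast_sum]
      rw [Parts.phi_cast, toList_ofList, ((sortS_perm _).map _).sum_eq, List.map_map]
      have hb : bsum (fun b => (1 : ℝ) + fat b) (Gen.merge X Y e) =
          ∑ i, bsum (fun b => (1 : ℝ) + fat b) (part st (Gen.merge X Y e) i).2 := by
        rw [sum_parts_eq st _ (fun q => bsum (fun b => (1 : ℝ) + fat b) q.2), bsum_eq_sum_clusterParts st _ (st e)]
        rfl
      have hl : ((nonhost st X Y e).map ((fun x : Shape => (x.phi : ℝ) + ((st e + 1 + 1 - x.root : ℕ) : ℝ) + 1) ∘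
            fun i => toShapeS st fat (part st (Gen.merge X Y e) i).2)).sum =
          ∑ i ∈ univ.filter (fun i => i ≠ hostIdx st X Y e),
            (((toShapeS st fat (part st (Gen.merge X Y e) i).2).phi : ℝ) +
              ((st e + 1 + 1 - (part st (Gen.merge X Y e) i).2.rootStep : ℕ) : ℝ) + 1) := by
        rw [sum_nonhost]
        refine sum_congr rfl fun i _ => ?_
        simp only [Function.comp, toShapeS_root]
      rw [hl, hb]
      have ih : ∀ i, ((toShapeS st fat (part st (Gen.merge X Y e) i).2).phi : ℝ) =
          bsum (fun b => (1 : ℝ) + fat b) (part st (Gen.merge X Y e) i).2 + (AG st (part st (Gen.merge X Y e) i).2 : ℝ) :=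
        fun i => phi_toShapeS (part st (Gen.merge X Y e) i).2
      rw [sum_congr rfl fun i _ => by rw [ih i], ih]
      have hsplit : ∀ f : Fin (npart st (Gen.merge X Y e)) → ℝ,
          ∑ i, f i = f (hostIdx st X Y e) + ∑ i ∈ univ.filter (fun i => i ≠ hostIdx st X Y e), f i := by
        intro f
        rw [← Finset.add_sum_erase univ f (mem_univ (hostIdx st X Y e)), filter_ne']
      rw [hsplit (fun i => bsum (fun b => (1 : ℝ) + fat b) (part st (Gen.merge X Y e) i).2),
        hsplit (fun i => (AG st (part st (Gen.merge X Y e) i).2 : ℝ))]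
      push_cast
      simp only [sum_add_distrib]
      ring
termination_by G => gsize G
decreasing_by
  all_goals first
    | (simp only [gsize]; omega)
    | exact gsize_lt_of_mem_jparts st _ _ (part_mem st _ _)

/-! ### The classes, for any shape reading of the parts -/

section Classes
variable {st fat} {X Y : Gen ε} {e : ε}
/-- **THE CLASSES** for any shape reading `ψ` injective on the non-host parts: the log-multinomial of the listed
shapes is the log-multinomial of the member's own class sizes `csize`. [folklore] -/
theorem lmult_eq_logMultinomial_csize_of (ψ : Gen ε → Shape)
    (hinj : ∀ i j, i ≠ hostIdx st X Y e → j ≠ hostIdx st X Y e →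
      ψ (part st (Gen.merge X Y e) i).2 = ψ (part st (Gen.merge X Y e) j).2 →
        (part st (Gen.merge X Y e) i).2 = (part st (Gen.merge X Y e) j).2) :
    (ofList ((nonhost st X Y e).map fun i => ψ (part st (Gen.merge X Y e) i).2)).lmult =
      logMultinomial univ (csize st X Y e) := by
  set h := hostIdx st X Y e with hh
  set φ : Fin (npart st (Gen.merge X Y e)) → Shape := fun i => ψ (part st (Gen.merge X Y e) i).2 with hφ
  set L := (nonhost st X Y e).map φ with hL
  set reps : Finset (Fin (npart st (Gen.merge X Y e))) := univ.filter fun j => key st X Y e j = some j with hreps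
  have hrep_ne : ∀ j ∈ reps, j ≠ h := by
    intro j hj
    rw [hreps, mem_filter] at hj
    exact (key_ne_none_iff j).1 (by rw [hj.2]; simp)
  -- counts of representatives
  have hcount : ∀ j ∈ reps, L.count (φ j) = csize st X Y e j := by
    intro j hj
    have hjh := hrep_ne j hj
    rw [hreps, mem_filter] at hj
    rw [hL, count_map_of_nodup φ (φ j) _ (nodup_nonhost st X Y e), toFinset_nonhost, filter_filter]
    unfold csize
    congr 1
    ext i
    simp only [mem_filter, mem_univ, true_and]
    constructor
    · rintro ⟨hih, hφi⟩
      have hp := hinj i j hih hjh hφi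
      rw [key_eq_of_part_eq hih hjh hp, hj.2]
    · intro hk
      refine ⟨(key_ne_none_iff i).1 (by rw [hk]; simp), ?_⟩
      simp only [hφ, part_eq_of_key_eq_some hk]
  -- the shape set is the image of the representatives
  have himage : L.toFinset = reps.image φ := by
    ext x
    rw [hL, List.mem_toFinset, List.mem_map, mem_image]
    constructor
    · rintro ⟨i, hi, rfl⟩
      have hih : i ≠ h := (mem_nonhost st).1 hi
      obtain ⟨j, hj⟩ := Option.ne_none_iff_exists'.1 ((key_ne_none_iff i).2 hih)
      refine ⟨j, by rw [hreps, mem_filter]; exact ⟨mem_univ _, key_rep hj⟩, ?_⟩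
      simp only [hφ, part_eq_of_key_eq_some hj]
    · rintro ⟨j, hj, rfl⟩
      exact ⟨j, (mem_nonhost st).2 (hrep_ne j hj), rfl⟩
  have hinjφ : Set.InjOn φ (reps : Set (Fin (npart st (Gen.merge X Y e)))) := by
    intro j hj j' hj' hjj
    have hjr := hj; have hjr' := hj'
    rw [mem_coe, hreps, mem_filter] at hjr hjr'
    have hp := hinj j j' (hrep_ne j hj) (hrep_ne j' hj') hjj
    have hk := key_eq_of_part_eq (hrep_ne j hj) (hrep_ne j' hj') hp
    rw [hjr.2, hjr'.2] at hk
    exact Option.some_injective _ hk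
  -- lengths
  have hlen : L.length = npart st (Gen.merge X Y e) - 1 := by
    rw [hL, List.length_map, ← List.toFinset_card_of_nodup (nodup_nonhost st X Y e), toFinset_nonhost, filter_ne',
      card_erase_of_mem (mem_univ _), card_univ, Fintype.card_fin]
  -- assemble
  unfold Parts.lmult logMultinomial
  rw [toList_ofList, List.sum_toFinset_count_eq_length, hlen, sum_csize]
  congr 1
  rw [himage, sum_image hinjφ]
  symm
  rw [← sum_subset (subset_univ reps) fun j _ hj => by
    rw [csize_eq_zero_of_not_rep (fun hk => hj (by rw [hreps, mem_filter]; exact ⟨mem_univ _, hk⟩))]; simp]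
  exact sum_congr rfl fun j hj => by beta_reduce; rw [hcount j hj]

end Classes

/-- the log-multinomial of a part list is invariant under permutations of the list [folklore] -/
theorem lmult_ofList_perm {l l' : List Shape} (h : l.Perm l') : (ofList l).lmult = (ofList l').lmult := by
  unfold Parts.lmult logMultinomial
  rw [toList_ofList, toList_ofList, List.toFinset_eq_of_perm l l' h]
  simp only [h.count_eq]

/-- **THE ENTROPY OF THE SORTED SHAPE** from the one order display: `ent (toShapeS G) = E G`. [folklore] -/
theorem ent_toShapeS : ∀ G : Gen ε, InjPartsS st fat G → (toShapeS st fat G).ent = E st G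
  | Gen.born b j, _ => by rw [toShapeS_born, E]; simp [Shape.ent]
  | Gen.renew G e h, hi => by
      rw [toShapeS_renew, E]; rw [InjPartsS] at hi; exact ent_toShapeS G hi
  | Gen.merge X Y e, hi => by
      rw [InjPartsS] at hi
      rw [toShapeS_merge, E]
      simp only [Shape.ent]
      rw [lmult_ofList_perm (sortS_perm _),
        lmult_eq_logMultinomial_csize_of (toShapeS st fat) hi.2,
        Parts.entSum_eq_sum, toList_ofList, ((sortS_perm _).map _).sum_eq, List.map_map]
      have hl : ((nonhost st X Y e).map (Shape.ent ∘ fun i => toShapeS st fat (part st (Gen.merge X Y e) i).2)).sum =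
          ∑ i ∈ univ.filter (fun i => i ≠ hostIdx st X Y e), E st (part st (Gen.merge X Y e) i).2 := by
        rw [sum_nonhost]
        exact sum_congr rfl fun i _ => ent_toShapeS _ (hi.1 i)
      rw [hl, ent_toShapeS _ (hi.1 _), ← Finset.add_sum_erase univ (fun i => E st (part st (Gen.merge X Y e) i).2)
        (mem_univ (hostIdx st X Y e)), filter_ne']
termination_by G => gsize G
decreasing_by
  all_goals first
    | (simp only [gsize]; omega)
    | exact gsize_lt_of_mem_jparts st _ _ (part_mem st _ _)

/-! ## §3 The ENDs without `ShapeSorted` -/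
/-- **THE SIBLING ENTROPY OF A MEMBER IS CLASS-LINEAR under `Mono` and `InjPartsS` only.** [folklore] -/
theorem E_leS (G : Gen ε) (hm : Mono st G) (hi : InjPartsS st fat G) :
    E st G ≤ 2 * bsum (fun b => (1 : ℝ) + fat b) G + 2 * (partnerAges st G : ℝ) + 4 * (NH st G : ℝ) := by
  have h := ent_le_two_mul_phi (toShapeS st fat G) (wf_toShapeS st fat G hm) (canon_toShapeS st fat G)
  rw [ent_toShapeS st fat G hi, phi_toShapeS st fat G] at h
  have hAG : (AG st G : ℝ) ≤ (partnerAges st G : ℝ) + 2 * (NH st G : ℝ) := by exact_mod_cast AG_le st G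
  linarith

/-- **IN THE BINDING'S LETTERS**: `Mono st G → InjPartsS st fat G →
ENT st G ≤ 2·bsum (1 + fat) G + 2·partnerAges st G + 4·mrg st G`. [folklore] -/
theorem ENT_leS (G : Gen ε) (hm : Mono st G) (hi : InjPartsS st fat G) :
    ENT st G ≤ 2 * bsum (fun b => (1 : ℝ) + fat b) G + 2 * (partnerAges st G : ℝ) + 4 * mrg st G := by
  rw [← E_eq_ENT, ← NH_cast_eq_mrg]
  exact E_leS st fat G hm hi

/-- **ON A PEDIGREE**: `HeadOldest` and `InjPartsS` alone. [folklore] -/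
theorem ENT_le_genT {α π : Type*} [DecidableEq α] [DecidableEq π] (P : HistoryGen.Pedigree α π)
    (hH : ∀ c, P.HeadOldest c) (fatL : HistoryGen.Lab α π → ℕ) (c : α)
    (hi : InjPartsS (PEv.step ∘ Prod.fst) fatL (P.genT c)) :
    ENT (PEv.step ∘ Prod.fst) (P.genT c) ≤
      2 * bsum (fun b => (1 : ℝ) + fatL b) (P.genT c) + 2 * (partnerAges (PEv.step ∘ Prod.fst) (P.genT c) : ℝ) +
        4 * mrg (PEv.step ∘ Prod.fst) (P.genT c) :=
  ENT_leS _ fatL _ (mono_genT P hH c) hi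

end

end Summit.QuantumFields.BalabanUV.T4Continuum.HistorySiblingEntropyBridge
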